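/-
Copyright (c) 2026 the pub-hodgecm-mathlib formalisation cell (harness21).  Prover seat hodgecm-mathlib-R90-C10-p02 (g2) (R90-TF SLAB, section S1 «Ch. 12 local»,
surplus hand on S1's last socket A2′ `stub_R90_122_keysThmTwo_ramifiedCharOne` = the K2E3 leaf (U4f-χ₁-ram-one), RULING R-S1-4; dealer of record K2E3-plan (g5)),
Track B «K2-LIT» ∕ h413 = `stmt-HodgeConjecture-24833`, line `K2_E3_EllipticInputs`, unit U4 «Keys», PART «U4Keys» socket :182 (U4f-χ₁-ram-one-pos)
`sig_K2E3KeysThmTwoContractingRamifiedCharOnePosDepth` (programme A_pos^{=} of K2E3-p37 (g0), memo `K2/K2E3-p37/g0/CENSUS-U4f-PosDepth.K2E3-p37-g0.md` §6–§10):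
brick §10 (c3)-T «THE ASSEMBLY UNDER THE TRACE-ONE LETTER» — ★ p863059 with `|2|_w = 1` replaced by an integral element of trace one (★ p862401∕p862457).  REPORT-FIRST 2026-09-04.
-/
import Summits.HodgeConjecture.HodgeConjecture.Theorems.K2E3BranchAIrreduciblePosDepth           -- ★ p863059 §10 (c3) (this seat): `levelN_le_iwahori`, the generic engine assembly `false_of_iwahoriDatum_of_cells`, the `h2`-version; brings ★ (a) (b) (c1) (c2), V1, the frame
import Summits.HodgeConjecture.HodgeConjecture.Theorems.K2E3LevelNDepthWitnessCMTraceOne          -- ★ p862401 (K2E3-p37 (g2)): `exists_depthWitness_of_mem_map_of_not_mem_of_traceOne` (the letter `hwit` on the intermediate cells under a trace-one `t`)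
import HarnessLib

/-!
# K2 ∕ E3 «EllipticInputs», unit U4 «Keys» — (U4f-χ₁-ram-one-pos), programme A_pos^{=} brick §10 (c3)-T: BRANCH A OF KEYS' THEOREM AT POSITIVE DEPTH UNDER THE TRACE-ONE LETTER
# «`χ₁` contracting, non-unitary, of conductor `m + 1 ≥ 2` with cond(`χ₁|_{F^×}`) = `m + 1`, `L_w ∋ t` integral with `t + σ_w t = 1`, and `χ₁ ∘ N ≠ 1` on `𝒪ˣ` ⟹ `i(χ₁, 1)` is
# IRREDUCIBLE» on `U(Φ₃)(L⁺_v)`, `v` non-split, (G3)-explicit frame   [Keys1984 §3, §7 Thm (2); Casselman1995 §6.4; Roche1998 §3–§4; MoyPrasad1996 §3; Serre1979 III §3]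

Cell hodgecm-mathlib, Track B «K2-LIT», crux item H413 = stmt-HodgeConjecture-24833 (route `HCCMUnconditional`, no route verbs); target BY NAME the OPEN tier-0 leaf
`…K2E3EllipticInputs.U4Keys.sig_K2E3KeysThmTwoContractingRamifiedCharOnePosDepth` (U4Keys ED. 8 :182), design D-I «vanishing functional» at POSITIVE depth, sub-case A_pos^{=}
(cond(`χ₁|_{F^×}`) = cond `χ₁` = `m + 1`).  Author R90-C10-p02 (g2).  `--supports stmt-HodgeConjecture-24833 --as helper`; THEOREMS ONLY; (G3)-EXPLICIT frame of ★ p861811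
(`L v w hw eA heA ϖ hϖ g₁ hg₁ K0 K1 I hK0 hK1 hI` + `gn hgn Jn hJn` at exponent `m + 1`) + `w₀ hw₀` + a Haar measure on `N(L⁺_v)`.  NOT THE PAYER of :182 (A_pos^{=} Branch A only;
the frame-free LEAF, A_pos^{<} and B_pos are other files).

THE POINT.  ★ p863059 `K2E3BranchAIrreduciblePosDepth.false_of_reducible_of_posDepth_of_normChar_ne_one` carries the letter `h2 : |2|_w = 1`, inherited from the model depth
witnesses ★ p861978 ∕ ★ p862033 (`b := −yσy∕2`, `b := c(z⁻¹ − (σz)⁻¹)∕2`).  K2E3-p37 (g2) removed it down to an INTEGRAL ELEMENT OF TRACE ONE `t` (`t + σ_w t = 1`, `|t|_w ≤ 1`: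
★ p862372 the witnesses, ★ p862401 their cover + CM dress `exists_depthWitness_of_mem_map_of_not_mem_of_traceOne`, ★ p862457 the sources of `t` — every non-dyadic and every
UNRAMIFIED dyadic `w`; the wildly ramified dyadic places are a genuine obstruction of the uniform-`J_n` road, memo `MEMO-WildDyadicResidual`).  THIS FILE is ★ p863059's §3 with
that one binder swapped (`h2 ↦ {t} ht hvt`) and the intermediate-cell witness taken from ★ p862401 instead of ★ p862149; everything else — ★ V1 (re-typed on arrival), ★ p861811
datum, the generic engine assembly ★ p863059 §2 `false_of_iwahoriDatum_of_cells` (Z2A-2 → V2b → ★ p861573), the torus witness ★ p862140, the big cell ★ p862185, `hθ`, `hΛ` —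
is called BY NAME.
* **`false_of_reducible_of_posDepth_of_normChar_ne_one_of_traceOne`** (frame + `w₀` + Haar; letters `hm ht hvt hcond u₁ hσu₁ hu₁ hχu₁ u hu hA`).
HONEST LABEL: HC_CM is proved only modulo the 7 printed citations (2 remaining named inputs: hLiu418 = stmt-HodgeConjecture-24832, h413 = stmt-HodgeConjecture-24833)
until rung 0 closes; count-neutral — this file does NOT pay the leaf; no printed citation is discharged.

## References
* [Keys1984] D. Keys, *Principal series representations of special unitary groups over local fields*, Compositio Math. 51 (1984), §3, §7 Thm (2).
* [Casselman1995] W. Casselman, *Introduction to the theory of admissible representations of `p`-adic reductive groups* (1995), §6.3–§6.4.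
* [Roche1998] A. Roche, *Types and Hecke algebras for principal series representations of split reductive p-adic groups*, Ann. Sci. ÉNS (4) 31 (1998), §3–§4.
* [MoyPrasad1996] A. Moy, G. Prasad, *Jacquet functors and unrefined minimal K-types*, Comment. Math. Helv. 71 (1996), §3.
* [Serre1979] J.-P. Serre, *Local Fields*, GTM 67 (1979), Ch. III §3 (trace and different: integral elements of trace one).
-/

set_option autoImplicit false
-- the mandated namespace has the single-problem summit's repeated segment (`HodgeConjecture.HodgeConjecture`)
set_option linter.dupNamespace false

noncomputable section

open NumberField IsDedekindDomain MeasureTheory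
open scoped Matrix MatrixGroups WithZero Valued
open Literature.NumberTheory Literature.NumberTheory.Automorphic Literature.NumberTheory.Automorphic.UnitaryGroup
open Literature.NumberTheory.Rogawski1990

namespace Summit.HodgeConjecture.HodgeConjecture.Cruxes.H413.K2E3BranchAIrreduciblePosDepthTraceOne

open Summit.HodgeConjecture.HodgeConjecture.Cruxes.H413
open Summit.HodgeConjecture.HodgeConjecture.Cruxes.H413.K2E3DepthZeroIwahoriCharacterCM
open Summit.HodgeConjecture.HodgeConjecture.Cruxes.H413.K2E3BranchALettersCM
open Summit.HodgeConjecture.HodgeConjecture.Cruxes.H413.K2E3BranchATypeLettersCM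
open Summit.HodgeConjecture.HodgeConjecture.Cruxes.H413.K2E3LevelNIwahoriCharacterCM
open Summit.HodgeConjecture.HodgeConjecture.Cruxes.H413.K2E3BranchAIrreduciblePosDepth

variable (L : Type) [Field L] [NumberField L] [IsCMField L] (v : HeightOneSpectrum (𝓞 ↥(maximalRealSubfield L)))
  (w : PlacesOver L v) (hw : IsCMField.complexConj L • w.1 = w.1)
  (eA : Gqs L v ≃ₜ* ↥(unitaryGroupOfForm (galAdicCompletionMap (L := L) (IsCMField.complexConj L) hw) ((StdForm.antidiagonal 3).over (w.1.adicCompletion L))))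
  (heA : ∀ g : Gqs L v,
    ((eA g : ↥(unitaryGroupOfForm (galAdicCompletionMap (L := L) (IsCMField.complexConj L) hw) ((StdForm.antidiagonal 3).over (w.1.adicCompletion L)))) :
        GL (Fin 3) (w.1.adicCompletion L)) =
      ((localNonsplitEquiv (IsCMField.complexConj L) (qsForm L) (IsCMField.complexConj_ne_one L) w hw g :
        ↥(unitaryGroupOfForm (galAdicCompletionMap (L := L) (IsCMField.complexConj L) hw) (placeForm (qsForm L) w.1))) : GL (Fin 3) (w.1.adicCompletion L)))
  {ϖ : w.1.adicCompletion L} (hϖ : Valued.v ϖ = WithZero.exp (-1 : ℤ))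
  (g₁ : GL (Fin 3) (w.1.adicCompletion L)) (hg₁ : (g₁ : Matrix (Fin 3) (Fin 3) (w.1.adicCompletion L)) = Matrix.diagonal ![(1 : w.1.adicCompletion L), 1, ϖ])
  (K0 K1 I : Subgroup (Gqs L v))
  (hK0 : K0 = ((glInt 3 (w.1.adicCompletion L)).subgroupOf
    (unitaryGroupOfForm (galAdicCompletionMap (L := L) (IsCMField.complexConj L) hw) ((StdForm.antidiagonal 3).over (w.1.adicCompletion L)))).comap
      eA.toMulEquiv.toMonoidHom)
  (hK1 : K1 = (((glInt 3 (w.1.adicCompletion L)).map (MulAut.conj g₁).toMonoidHom).subgroupOf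
    (unitaryGroupOfForm (galAdicCompletionMap (L := L) (IsCMField.complexConj L) hw) ((StdForm.antidiagonal 3).over (w.1.adicCompletion L)))).comap
      eA.toMulEquiv.toMonoidHom)
  (hI : I = K0 ⊓ K1)
  {m : ℕ} (gn : GL (Fin 3) (w.1.adicCompletion L))
  (hgn : (gn : Matrix (Fin 3) (Fin 3) (w.1.adicCompletion L)) = Matrix.diagonal ![(1 : w.1.adicCompletion L), 1, ϖ ^ (m + 1)])
  (Jn : Subgroup (Gqs L v))
  (hJn : Jn = K0 ⊓ (((glInt 3 (w.1.adicCompletion L)).map (MulAut.conj gn).toMonoidHom).subgroupOf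
    (unitaryGroupOfForm (galAdicCompletionMap (L := L) (IsCMField.complexConj L) hw) ((StdForm.antidiagonal 3).over (w.1.adicCompletion L)))).comap
      eA.toMulEquiv.toMonoidHom)

/-! ## Branch A at positive depth under the trace-one letter -/

open Classical in
include hw heA hϖ hg₁ hK0 hK1 hI hgn hJn in
set_option maxHeartbeats 1600000 in
set_option synthInstance.maxHeartbeats 400000 in
-- the Gqs-typed ★ letters meet the subtype-typed engine goals (instance unfolding); V1's witness is re-typed on arrival (class of ★ p863059)
/-- **BRANCH A OF KEYS' THEOREM AT POSITIVE DEPTH UNDER THE TRACE-ONE LETTER (design D-I, sub-case A_pos^{=}, (G3) frame).**  As ★ p863059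
`false_of_reducible_of_posDepth_of_normChar_ne_one` with the letter `h2 : |2|_w = 1` REPLACED by an integral `t ∈ L_w` of trace one (`t + σ_w t = 1`, `|t|_w ≤ 1` — holds at
every non-dyadic and every unramified dyadic `w`, ★ p862457): `v` non-split; `χ₁` continuous, non-unitary, contracting, of conductor `≤ m + 1` (`hcond`, `1 ≤ m`); an exact-conductor
witness `u₁` (`σ`-fixed, `≡ 1 mod 𝔭ᵐ`, `χ₁ u₁ ≠ 1`); a unit `u` with `χ₁(u·σu) ≠ 1`; `w₀` of matrix `Φ₃`; `μ` Haar on `N`.  Then `i(χ₁, 1)` is NOT reducible: ★ V1 → ★ p861811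
datum → ★ p863059 §2 `false_of_iwahoriDatum_of_cells` with `hwit` from ★ p862140 (torus) and ★ p862401 (trace-one intermediate witnesses), `hcells` over ★ p862185.
[cite: Keys1984, §3, §7 Thm (2)] [cite: Casselman1995, §6.4] [cite: Roche1998, §3–§4] [cite: MoyPrasad1996, §3] [cite: Serre1979, Ch. III §3] -/
theorem false_of_reducible_of_posDepth_of_normChar_ne_one_of_traceOne
    (hns : ∀ w' : PlacesOver L v, IsCMField.complexConj L • w'.1 = w'.1)
    (χ₁ : (LocalRing L v)ˣ →* ℂˣ) (h₁ : Continuous fun x => ((χ₁ x : ℂˣ) : ℂ)) (hnu : ∃ x, ‖((χ₁ x : ℂˣ) : ℂ)‖ ≠ 1)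
    (hcontr : ∀ x : (LocalRing L v)ˣ, unitModulusChar (LocalRing L v) x < 1 → ‖((χ₁ x : ℂˣ) : ℂ)‖ < 1)
    (hm : 1 ≤ m) {t : w.1.adicCompletion L} (ht : t + galAdicCompletionMap (L := L) (IsCMField.complexConj L) hw t = 1) (hvt : Valued.v t ≤ 1)
    (hcond : ∀ u : (LocalRing L v)ˣ, (∀ w' : PlacesOver L v, Valued.v (((u : LocalRing L v) w') - 1) ≤ Valued.v ϖ ^ (m + 1)) → χ₁ u = 1)
    (u₁ : (LocalRing L v)ˣ) (hσu₁ : Units.map (conjLocal L (IsCMField.complexConj L) v : LocalRing L v →* LocalRing L v) u₁ = u₁)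
    (hu₁ : ∀ w' : PlacesOver L v, Valued.v (((u₁ : LocalRing L v) w') - 1) ≤ Valued.v ϖ ^ m) (hχu₁ : χ₁ u₁ ≠ 1)
    (u : (LocalRing L v)ˣ) (hu : ∀ w' : PlacesOver L v, Valued.v ((u : LocalRing L v) w') = 1)
    (hA : χ₁ (u * Units.map (conjLocal L (IsCMField.complexConj L) v : LocalRing L v →* LocalRing L v) u) ≠ 1)
    (w₀ : ↥(unitaryGroupOfForm (conjLocal L (IsCMField.complexConj L) v) (cmLocalForm L 3 v)))
    (hw₀ : Units.val (w₀ : GL (Fin 3) (LocalRing L v)) = cmLocalForm L 3 v)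
    [MeasurableSpace ↥(cmBorelTriple L 3 v).N] [BorelSpace ↥(cmBorelTriple L 3 v).N] (μ : Measure ↥(cmBorelTriple L 3 v).N) [μ.IsHaarMeasure]
    (hred : ∃ N : Subrepresentation (cmPrincipalSeries L 3 v (cmTorusCharPair L v χ₁ 1)), N ≠ ⊥ ∧ N ≠ ⊤) : False := by
  haveI := locallyCompactSpace_cmBorelU L 3 v
  have hJI : Jn ≤ I := levelN_le_iwahori L v w hw eA hϖ g₁ hg₁ K0 K1 I hK0 hK1 hI gn hgn Jn hJn
  -- `w₀² = 1` (★ `w₀_mul_w₀_mem` at the trivial subgroup)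
  have hww : w₀ * w₀ = 1 := Subgroup.mem_bot.1 (w₀_mul_w₀_mem L v w hw eA heA ⊥ w₀ hw₀)
  have hwinv : w₀⁻¹ = w₀ := inv_eq_of_mul_eq_one_right hww
  -- ★ V1: a `G`-stable `V ∋ f`, `f(1) ≠ 0`, killed by the intertwining functional `Λ_{w₀}`
  have h₂ : Continuous fun x : ↥(normOneUnits (conjLocal L (IsCMField.complexConj L) v)) =>
      (((1 : ↥(normOneUnits (conjLocal L (IsCMField.complexConj L) v)) →* ℂˣ) x : ℂˣ) : ℂ) := by
    simp only [MonoidHom.one_apply]; exact continuous_const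
  -- (the witness is RE-TYPED in the generic `smoothIndRep` currency of §2 on arrival: `cmPrincipalSeries` unfolds to it, and doing the unfolding here,
  -- against a mvar-free target, keeps the §2 application below syntactic — the depth-zero template pays 16 M heartbeats for the same meeting)
  obtain ⟨V, f, hfV, hf1, hΛ⟩ : ∃ (V : Subrepresentation (Representation.smoothIndRep (cmBorelTriple L 3 v).P
      (Representation.twist
      (((Representation.trivial ℂ ↥(torusU (conjLocal L (IsCMField.complexConj L) v) (cmLocalForm L 3 v)) ℂ).twist
        (cmTorusCharPair L v χ₁ 1)).comp (cmBorelTriple L 3 v).proj) (rootDeltaChar (cmBorelTriple L 3 v).P))))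
      (f : Representation.SmoothInd (cmBorelTriple L 3 v).P
      (Representation.twist
      (((Representation.trivial ℂ ↥(torusU (conjLocal L (IsCMField.complexConj L) v) (cmLocalForm L 3 v)) ℂ).twist
        (cmTorusCharPair L v χ₁ 1)).comp (cmBorelTriple L 3 v).proj) (rootDeltaChar (cmBorelTriple L 3 v).P))),
      f ∈ V ∧ f.toFun 1 ≠ 0 ∧ ∀ f', f' ∈ V → ∀ g : ↥(unitaryGroupOfForm (conjLocal L (IsCMField.complexConj L) v) (cmLocalForm L 3 v)),
        ∫ n : ↥(cmBorelTriple L 3 v).N, f'.toFun (w₀ * (n : ↥(unitaryGroupOfForm (conjLocal L (IsCMField.complexConj L) v) (cmLocalForm L 3 v))) * g) ∂μ = 0 :=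
    K2E3IntertwiningKernelOfReducible.exists_section_apply_one_ne_zero_forall_intertwiningIntegral_eq_zero L v hns χ₁ 1 h₁ h₂ hnu hcontr hred w₀ hw₀ μ
  -- ★ p862140 (c2): the level-`(m+1)` torus witness at `w₀`; ★ p862401: the trace-one depth witnesses at the intermediate representatives
  obtain ⟨b₀, hb₀P, hb₀J, -, hne⟩ := K2E3BranchATorusWitnessLevelN.exists_torusWitness_levelN L v w hw eA heA hϖ g₁ hg₁ K0 K1 I hK0 hK1 hI gn hgn Jn hJn
    w₀ hw₀ χ₁ u hu hA
  have hwitI : ∀ r : Gqs L v, r ∈ ((cmBorelTriple L 3 v).N).map (MulAut.conj w₀).toMonoidHom →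
      Valued.v ((((eA r : ↥(unitaryGroupOfForm (galAdicCompletionMap (L := L) (IsCMField.complexConj L) hw) ((StdForm.antidiagonal 3).over (w.1.adicCompletion L)))) :
        GL (Fin 3) (w.1.adicCompletion L)) : Matrix (Fin 3) (Fin 3) (w.1.adicCompletion L)) 2 0) < 1 → r ∉ Jn →
      ∃ (b : Gqs L v) (hbP : ((r * b * r⁻¹ : Gqs L v) : ↥(unitaryGroupOfForm (conjLocal L (IsCMField.complexConj L) v) (cmLocalForm L 3 v))) ∈ (cmBorelTriple L 3 v).P),
        b ∈ Jn ∧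
        (if h : IsUnit (((b.val : GL (Fin 3) (LocalRing L v)) : Matrix (Fin 3) (Fin 3) (LocalRing L v)) 0 0) then ((χ₁ h.unit : ℂˣ) : ℂ) else 0) ≠
          (Representation.twist
              (((Representation.trivial ℂ ↥(torusU (conjLocal L (IsCMField.complexConj L) v) (cmLocalForm L 3 v)) ℂ).twist
                (cmTorusCharPair L v χ₁ 1)).comp (cmBorelTriple L 3 v).proj) (rootDeltaChar (cmBorelTriple L 3 v).P))
            ⟨((r * b * r⁻¹ : Gqs L v) : ↥(unitaryGroupOfForm (conjLocal L (IsCMField.complexConj L) v) (cmLocalForm L 3 v))), hbP⟩ 1 :=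
    fun r hr hz hoff => K2E3LevelNDepthWitnessCMTraceOne.exists_depthWitness_of_mem_map_of_not_mem_of_traceOne L v w hw eA heA hϖ K0 hK0 gn hgn Jn hJn w₀ hw₀
      hm ht hvt χ₁ hcond u₁ hσu₁ hu₁ hχu₁ hr hz hoff
  -- §1 of ★ p861811: the Iwahori datum with `K 0 = J_{m+1}`, `K 1 = I`, `N̄ = eA⁻¹(N̄_w)`
  obtain ⟨𝓘, hK0J, -, hNbar⟩ := K2E3IwahoriLevelNLettersCM.exists_iwahoriDatum_K_zero_eq_levelN L v w hw eA heA hϖ g₁ hg₁ K0 K1 I hK0 hK1 hI gn hgn Jn hJn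
    (by omega)
  subst hK0J
  -- ★ p863059 §2 with `B := J_{m+1}`, `θ(g) = χ₁(unit g₀₀)`, `R := {w₀} ∪ {intermediate representatives}`
  refine false_of_iwahoriDatum_of_cells (cmBorelTriple L 3 v)
    (Representation.twist
      (((Representation.trivial ℂ ↥(torusU (conjLocal L (IsCMField.complexConj L) v) (cmLocalForm L 3 v)) ℂ).twist
        (cmTorusCharPair L v χ₁ 1)).comp (cmBorelTriple L 3 v).proj) (rootDeltaChar (cmBorelTriple L 3 v).P)) 𝓘 μ
    (LineRing.isClosed_unipotentU (conjLocal L (IsCMField.complexConj L) v) (cmLocalForm L 3 v))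
    (fun g : ↥(unitaryGroupOfForm (conjLocal L (IsCMField.complexConj L) v) (cmLocalForm L 3 v)) =>
      if h : IsUnit (((g : GL (Fin 3) (LocalRing L v)) : Matrix (Fin 3) (Fin 3) (LocalRing L v)) 0 0) then ((χ₁ h.unit : ℂˣ) : ℂ) else 0)
    (fun x hx y hy => theta_mul_pow L v w hw eA heA hϖ K0 hK0 gn hgn (𝓘.K 0) hJn (by omega) χ₁ hcond hx hy)
    (fun p hp hpJ => theta_eq_tau_of_mem L v w hw eA heA hϖ g₁ hg₁ K0 K1 I hK0 hK1 hI χ₁ p hp (hJI hpJ))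
    (fun c hc => theta_eq_one_of_map_mem L v w hw eA heA χ₁ (by
      have h := (Subgroup.mem_inf.1 hc).2
      rw [hNbar] at h
      exact h))
    V f hfV hf1 w₀ (by rw [hww]; exact Subgroup.one_mem _)
    ({w₀} ∪ {r : ↥(unitaryGroupOfForm (conjLocal L (IsCMField.complexConj L) v) (cmLocalForm L 3 v)) |
      r ∈ ((cmBorelTriple L 3 v).N).map (MulAut.conj w₀).toMonoidHom ∧
      Valued.v ((((eA r : ↥(unitaryGroupOfForm (galAdicCompletionMap (L := L) (IsCMField.complexConj L) hw) ((StdForm.antidiagonal 3).over (w.1.adicCompletion L)))) :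
        GL (Fin 3) (w.1.adicCompletion L)) : Matrix (Fin 3) (Fin 3) (w.1.adicCompletion L)) 2 0) < 1 ∧ r ∉ 𝓘.K 0})
    ?_ ?_ (fun n _ => theta_conj_eq_one L v w hw eA heA (cmBorelTriple L 3 v) rfl w₀ hw₀ χ₁ n.2) (fun f' hf'V => hΛ f' hf'V w₀)
  · -- `hwit`: the torus witness at `w₀` (★ p862140), ★ p862401 at an intermediate representative
    rintro r (hr | ⟨hr, hz, hoff⟩)
    · rw [Set.mem_singleton_iff] at hr
      subst hr
      exact ⟨b₀, hb₀J, hb₀P, hne⟩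
    · obtain ⟨b, hbP, hbJ, hne'⟩ := hwitI r hr hz hoff
      exact ⟨b, hbJ, hbP, hne'⟩
  · -- `hcells`: the trichotomy
    intro n
    by_cases hJ : w₀ * (n : ↥(unitaryGroupOfForm (conjLocal L (IsCMField.complexConj L) v) (cmLocalForm L 3 v))) * w₀ ∈ 𝓘.K 0
    · exact Or.inl hJ
    right
    by_cases hz : 1 ≤ Valued.v ((((eA (w₀ * (n : ↥(unitaryGroupOfForm (conjLocal L (IsCMField.complexConj L) v) (cmLocalForm L 3 v))) * w₀) :
        ↥(unitaryGroupOfForm (galAdicCompletionMap (L := L) (IsCMField.complexConj L) hw) ((StdForm.antidiagonal 3).over (w.1.adicCompletion L)))) :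
          GL (Fin 3) (w.1.adicCompletion L)) : Matrix (Fin 3) (Fin 3) (w.1.adicCompletion L)) 2 0)
    · -- ★ p862185 (c1): the big cell `w₀ n w₀ = h · w₀ · b′`
      obtain ⟨h, hh, b', hb', e⟩ := K2E3LowerUnipotentBigCellCM.exists_eq_borel_mul_weyl_mul_levelN_of_one_le_v L v w hw eA heA hϖ K0 hK0 gn hgn (𝓘.K 0) hJn
        (cmBorelTriple L 3 v) rfl w₀ hw₀ n.2 hz
      exact ⟨w₀, Set.mem_union_left _ (Set.mem_singleton w₀), h, hh, b', hb', e⟩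
    · -- an intermediate representative: `r := w₀ n w₀` itself, `h = b′ = 1`
      have hmem : w₀ * (n : ↥(unitaryGroupOfForm (conjLocal L (IsCMField.complexConj L) v) (cmLocalForm L 3 v))) * w₀ ∈
          ((cmBorelTriple L 3 v).N).map (MulAut.conj w₀).toMonoidHom :=
        Subgroup.mem_map.2 ⟨n, n.2, by rw [MulEquiv.coe_toMonoidHom, MulAut.conj_apply, hwinv]⟩
      refine ⟨w₀ * (n : ↥(unitaryGroupOfForm (conjLocal L (IsCMField.complexConj L) v) (cmLocalForm L 3 v))) * w₀, Set.mem_union_right _ ?_, 1, Subgroup.one_mem _, 1, Subgroup.one_mem _,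
        by rw [one_mul, mul_one]⟩
      rw [Set.mem_setOf_eq]
      exact ⟨hmem, not_le.1 hz, hJ⟩

end Summit.HodgeConjecture.HodgeConjecture.Cruxes.H413.K2E3BranchAIrreduciblePosDepthTraceOne

end
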